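import Summits.BirchSwinnertonDyer.BirchSwinnertonDyer.Theorems.CMKolyvaginAtInertTwoCertificateOneBitBSDTwoOfPrintedInputs
import HarnessLib

/-!
# Route `CMKolyvaginAtInertTwo`, crux HL′ `CMSilentHeegnerTwinSupplyAtInertTwo` (stmt-BirchSwinnertonDyer-28663):
# THE UNIVERSAL FRAME — a prime `p ≡ −1 (mod 4N_E)` with `L(E^{(−p)},1) ≠ 0` IS a silent Heegner twin

Seat `bsd-line-cmk2-p1` g22 (cell `bsd-print-cf2`), `--supports stmt-BirchSwinnertonDyer-28663` (helper; closes nothing by name).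
THEOREMS ONLY (no definition, no named fact, no `sorry`).  BSD is NOT proved by this; HL′ is NOT proved by this.

The pen's HL′ memo rev 4 §7 (bsd-idea-1 g23, `cmk-rev20/HLUniv_preview.lean`, glue stub `sorry`) observes: for a prime `p` with
`4·N_E ∣ p + 1`, the discriminant `−p` is odd and fundamental, every prime `ℓ ∣ N_E` splits in `ℚ(√−p)` (`−p ≡ 1 (mod ℓ)`, and
`(mod 8)` when `2 ∣ N_E`), and `|−p| = p` is prime, so the genus defect is `Σ_E(−p) = 1` (g22 `sum_defect_le_one_of_prime_of_cmInert_two`: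
`(Δ/p) = −1` since `Δ < 0` on H₂).  Also `p ≥ 11` because the CM prime `|d_F| ≥ 3` divides `N_E`
(`ShaCountTwo.natAbs_cmFieldDiscr_dvd_conductorNorm`), so `−p ≠ −3`.  Hence the pen's HL‴

  `PrimeTwistSupplyAtMinusOneModFourN` : «for `E ∈ H₂` (CM, `2` inert in `F`, `ρ̄_{E,2}` onto, `r_an = 1`) some prime `p` with
  `4N_E ∣ p + 1` has `L(E^{(−p)}, 1) ≠ 0`»

implies HL′ — THIS FILE PROVES THAT GLUE (the preview's `stub_silentSupply_of_primeTwistSupply`):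

* `exists_silentHeegnerField_of_prime_twist` — per curve: such a `p` yields the HL′ field (`K` with `d_K = −p`: imaginary quadratic,
  odd, `≠ −3`, Heegner for `N_E`, `Σ ≤ 1`, `L(E^{(d_K)},1) ≠ 0`), via the tree's dictionary `exists_heegnerField_iff_exists_fundamental`
  (fundamental discriminants ↔ imaginary quadratic fields, Heegner ↔ Kronecker conditions).
* **`cmSilentHeegnerTwinSupply_of_primeTwistSupply`** — HL‴ (its body as a hypothesis) ⟹ `CMSilentHeegnerTwinSupplyAtInertTwo`.

So HL′ reduces to a prime-twist non-vanishing statement in ONE residue class `p ≡ −1 (mod 4N_E)` (Ono–Skinner / Ono 2001 territory; the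
pen's instrument HLUNIV-g23, kit j338966: 61/80 hits, every cell hit).  Nothing analytic is proved here.

References: [GrossLMS1991] §2 (Heegner hypothesis); [GrossZagier1986] I.§3; [OnoSkinner1998] Cor. 2 (shape of HL‴); [Kramer1981] Prop. 3.
-/

set_option autoImplicit false
-- the Theorems namespace of this sub repeats the summit name by design (D-0017 nested layout)
set_option linter.dupNamespace false

noncomputable section

open scoped Classical

open WeierstrassCurve NumberField Literature.NumberTheory.EllipticCurves
  Literature.NumberTheory.EllipticCurves.Rank1Residual
open Summit.BirchSwinnertonDyer.BirchSwinnertonDyer.Theses.CMKolyvaginAtInertTwo (CMSilentHeegnerTwinSupplyAtInertTwo)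

namespace Summit.BirchSwinnertonDyer.BirchSwinnertonDyer.Theorems.KolyvaginLowerTwo

/-- **A prime `p` with `4N_E ∣ p + 1` and `L(E^{(−p)},1) ≠ 0` gives the HL′ field of `E ∈ H₂`.**  `W/ℚ` globally minimal with CM, `2`
inert in the CM field, `ρ̄_{E,2}` onto; `p` prime, `4·N_W ∣ p + 1`, `L(W^{(−p)}, 1) ≠ 0`.  Then there is an imaginary quadratic `K` with
`d_K = −p`: odd, `≠ −3` (`p ≥ 11` as `3 ≤ |d_F| ∣ N_W`), every prime of `N_W` split in `K` (`−p ≡ 1 (mod ℓ)`, `(mod 8)` at `ℓ = 2`),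
genus defect `Σ ≤ 1` (`|d_K|` prime, `Δ < 0`) and `L(W^{(d_K)},1) ≠ 0`. [cite: GrossLMS1991, §2 (Heegner hypothesis)] [cite: Kramer1981, Prop. 3] -/
theorem exists_silentHeegnerField_of_prime_twist (W : WeierstrassCurve ℚ) [W.IsElliptic] [W.IsGloballyMinimal]
    [NeZero (W.conductorNorm ℤ)] (hCM : W.HasCM) (hin : Rank1Residual.CMInert W 2) (hρ2 : W.HasSurjectiveModNGaloisRep 2)
    {p : ℕ} (hp : p.Prime) (hdvd : (4 * W.conductorNorm ℤ : ℕ) ∣ p + 1)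
    (hL : (W.quadraticTwist (-(p : ℚ))).entireLFunction 1 ≠ 0) :
    ∃ (K : Type) (_ : Field K) (_ : NumberField K), IsImaginaryQuadratic K ∧ Odd (NumberField.discr K) ∧
      NumberField.discr K ≠ -3 ∧ SatisfiesHeegnerHypothesis (W.conductorNorm ℤ) K ∧
      (∑ q ∈ (NumberField.discr K).natAbs.primeFactors,
        ((if jacobiSym W.Δ.num q = -1 then 1 else 0) + (if jacobiSym W.Δ.num q = 1 ∧ Even (W.frobeniusTrace q) then 2 else 0)) ≤ 1) ∧
      (W.quadraticTwist (NumberField.discr K : ℚ)).entireLFunction 1 ≠ 0 := by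
  set N : ℕ := W.conductorNorm ℤ with hN
  -- `3 ≤ |d_F| ∣ N`, so `12 ≤ 4N ≤ p + 1`
  have hN0 : N ≠ 0 := NeZero.ne N
  obtain ⟨hℓP, hℓ4, -⟩ := ShaCountTwo.prime_natAbs_cmFieldDiscr_of_cmInert_two W hin
  have hℓN : (cmFieldDiscrOfJ W.j).natAbs ∣ N := ShaCountTwo.natAbs_cmFieldDiscr_dvd_conductorNorm W hCM hin hρ2
  have hℓ3 : 3 ≤ (cmFieldDiscrOfJ W.j).natAbs := by
    have := hℓP.two_le
    omega
  have hN3 : 3 ≤ N := le_trans hℓ3 (Nat.le_of_dvd (Nat.pos_of_ne_zero hN0) hℓN)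
  obtain ⟨t, ht⟩ := hdvd
  have h4 : 4 ∣ p + 1 := ⟨N * t, by rw [ht]; ring⟩
  have hp11 : 11 ≤ p := by
    have hk : p + 1 = 4 * (N * t) := by rw [ht]; ring
    have ht0 : 1 ≤ t := by
      rcases Nat.eq_zero_or_pos t with rfl | h
      · omega
      · exact h
    have h3k : 3 ≤ N * t := le_trans hN3 (Nat.le_mul_of_pos_right N ht0)
    generalize N * t = k at hk h3k
    omega
  -- the fundamental discriminant `D = -p`
  set D : ℤ := -(p : ℤ) with hD
  have hDneg : D < 0 := by
    have : (0 : ℤ) < p := by exact_mod_cast hp.pos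
    omega
  have hD4 : D % 4 = 1 := by omega
  have hD1 : D ≠ 1 := by omega
  have hsq : Squarefree D := by
    rw [← Int.squarefree_natAbs, hD, Int.natAbs_neg, Int.natAbs_natCast]
    exact hp.squarefree
  have hB : 0 < D.natAbs := Int.natAbs_pos.mpr hDneg.ne
  -- the Kronecker conditions at the primes of `N`
  have hkr : ∀ q : ℕ, q.Prime → q ∣ N → (q = 2 → D % 8 = 1) ∧ (q ≠ 2 → jacobiSym D q = 1) := by
    intro q hq hqN
    obtain ⟨u, hu⟩ := hqN
    have h' : p + 1 = 4 * (q * u) * t := by rw [← hu]; exact ht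
    refine ⟨fun hq2 ↦ ?_, fun _ ↦ ?_⟩
    · subst hq2
      have h8 : 8 ∣ p + 1 := ⟨u * t, by rw [h']; ring⟩
      omega
    · have hq1 : (1 : ℤ) < q := by exact_mod_cast hq.one_lt
      have hmod : D % q = 1 := by
        have h'' : ((p : ℤ) + 1) = 4 * ((q : ℤ) * u) * t := by exact_mod_cast h'
        have hDq : D = 1 + (q : ℤ) * (-(4 * (u : ℤ) * t)) := by
          rw [hD]
          linarith
        rw [hDq, Int.add_mul_emod_self_left]
        exact Int.emod_eq_of_lt (by norm_num) hq1
      rw [jacobiSym.mod_left, hmod, jacobiSym.one_left]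
  -- the field
  obtain ⟨K, _, _, hK, -, hH, hDK⟩ :=
    (exists_heegnerField_iff_exists_fundamental N 0 (fun D' ↦ D' = D)).mpr
      ⟨D, hDneg, Or.inl ⟨hD4, hsq, hD1⟩, hB, hkr, rfl⟩
  have hodd : Odd (NumberField.discr K) := by
    rw [hDK, Int.odd_iff]
    omega
  have h3 : NumberField.discr K ≠ -3 := by
    rw [hDK]
    omega
  have hq : (NumberField.discr K).natAbs.Prime := by
    rw [hDK, hD, Int.natAbs_neg, Int.natAbs_natCast]
    exact hp
  refine ⟨K, inferInstance, inferInstance, hK, hodd, h3, hH,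
    sum_defect_le_one_of_prime_of_cmInert_two W hCM hin hρ2 K hK hodd hH hq, ?_⟩
  rw [hDK, hD]
  push_cast
  exact hL

/-- **HL‴ ⟹ HL′: the universal-frame prime-twist supply implies the silent Heegner twin supply** (crux 28663
`CMSilentHeegnerTwinSupplyAtInertTwo`).  The hypothesis is the BODY of the pen's `PrimeTwistSupplyAtMinusOneModFourN`: for every `W ∈ H₂`
(globally minimal, CM, `2` inert in the CM field, `ρ̄_{E,2}` onto, `r_an = 1`) some prime `p` with `4N_W ∣ p + 1` has `L(W^{(−p)},1) ≠ 0`.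
This is the glue `stub_silentSupply_of_primeTwistSupply` of the preview, proved; HL‴ itself (Ono–Skinner-type non-vanishing in one residue
class) is NOT proved here. [cite: GrossLMS1991, §2 (Heegner hypothesis)] [cite: OnoSkinner1998, Cor. 2 (shape of the supply; nothing asserted)] -/
theorem cmSilentHeegnerTwinSupply_of_primeTwistSupply
    (hSup : ∀ (W : WeierstrassCurve ℚ) [W.IsElliptic] [W.IsGloballyMinimal] [NeZero (W.conductorNorm ℤ)],
      W.HasCM → Rank1Residual.CMInert W 2 → W.HasSurjectiveModNGaloisRep (2 : ℤ) → W.analyticRank = 1 →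
      ∃ p : ℕ, p.Prime ∧ (4 * W.conductorNorm ℤ : ℕ) ∣ p + 1 ∧ (W.quadraticTwist (-(p : ℚ))).entireLFunction 1 ≠ 0) :
    CMSilentHeegnerTwinSupplyAtInertTwo := by
  intro W _ _ _ hCM hin hρ hr
  obtain ⟨p, hp, hdvd, hL⟩ := hSup W hCM hin hρ hr
  exact exists_silentHeegnerField_of_prime_twist W hCM hin hρ hp hdvd hL

end Summit.BirchSwinnertonDyer.BirchSwinnertonDyer.Theorems.KolyvaginLowerTwo

end
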